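import Mathlib
import Summits.Ventures.HodgeRepro.Tier4.Line1.RtfSpectral
import Summits.Ventures.HodgeRepro.Tier4.Line1.RTFSide

/-!
# Tier4/Line1/SpectralOfRTF — the RTF-DEFINED spectral interface of LINE L1: the seesaw binder `hseesaw` of
`conclusion_of_rtf_inputs` made explicit on DEFINED objects

Blind re-derivation cell `pub-hodge-repro`, Tier 4 (README §9–§10), seat t4-L1-p1 (gen 3).  Target tree path
`lean/Summits/Ventures/HodgeRepro/Tier4/Line1/SpectralOfRTF.lean`.  Imports t4-L1-p4's `RtfSpectral` (L1.2b, the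
spectral expansion of `J(f₁ ⋆ f₂)` as a `HasSum` over the adapted orthonormal family) and t4-L1-p3's `RTFSide`
(`sideWithRTFSpectrum`, `P_of_rtf_inputs`, `conclusion_of_rtf_inputs`); through them night-2's `SpectralInterface`,
`SpectralDecomposition`, `TermFactors`, `IsolateTerm`, `SeesawComponents`, `P_of_P'_of_components`.

WHAT THIS IS (the (I4-S) diagnosis, proofs/t4/L1/I4-seesaw-diagnosis-t4-L1-p1.md).  The residual lemma
`conclusion_of_rtf_inputs` displays the seesaw as `hseesaw : ∃ Sp : SpectralInterface I, SeesawComponents I Sp` on the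
RTF-instantiated face `I`.  That binder has no DEFINED clause: its (S1) relates typer-1's concrete Hodge pairing
`W.hodgePairing γ` (forms on `X_{Γ′}`) to data on `L²([U(W)])`, two tree objects with no map between them (the theta
correspondence, never typed here); its (S3) needs the Hecke translates to act on the RTF spectrum (no tree object) and
the Rallis non-vanishing.  This file does the only honest thing available: it DEFINES the spectral interface from the
RTF's own spectral expansion, so that the binder becomes two explicit identities over DEFINED numbers:
* `specTerm S χ χ' φ f₁ f₂ j` = the `j`-th term of `rtf_spectral`, `specBlock … n … m = ∑' j : n ⁻¹' {m}, specTerm … j`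
  the `τ m`-block; `hasSum_specBlock`: `J(f₁ ⋆ f₂) = Σ_m specBlock m` (Mathlib's `HasSum.tsum_fiberwise`);
  `atoms_of_specBlock_ne_zero`: a non-zero block carries both toric functionals and is hit by `f̄₁` (L1.5 `atoms`).
* `spectralOfRTF tf spec : SpectralInterface I` for a DISPLAYED test-pair map `tf : W.Translates → (G → ℂ) × (G → ℂ)`
  (the test functions of a Hecke choice — the (D2)/(D3) data of night-2, not in the tree) and a displayed finite
  spectrum `spec`: `spectrum := spec`, `tauPairing γ m := specBlock … (tf γ).1 (tf γ).2 m`.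
* On it (S2) is a THEOREM modulo the lift clause (`termFactors_spectralOfRTF`); (S1) IS the displayed identity
  `SpectralIdentification`: `∀ γ, W.hodgePairing γ = ∑ m ∈ spec γ, specBlock … (tf γ) m` — the identification (i) of
  ROUTE.md §4 item 2 in its printed shape ((D0) Liu 2021 Prop 4.13 / BMM Cor 65, (D2) Bergeron 2006 Thm 1.1 + the
  seesaw, Howe duality for the cross terms) and nothing else; (S3) IS the displayed `IsolationNonvanishing`:
  «both toric functionals on `τ m` and `Lift m` ⟹ some Hecke choice has spectrum `{m}` and a non-zero `m`-block»
  (Hecke isolation + the Rallis inner product formula, N. Harris IMRN 2014 Thm 5.15).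
* `seesawComponents_spectralOfRTF` rebuilds `hseesaw` by name from the two identities (+ the lift clause for (S2));
  `P_of_rtf_identification` / `conclusion_of_rtf_identification` restate p3's assembly with `hseesaw` replaced by
  (S1′) + (S3′) — the costume `line1_realise d` with its seesaw half displayed as two identities over DEFINED numbers.
NOTHING of the seesaw is proved here: (S1′) and (S3′) are hypotheses of every theorem that uses them, displayed by
name, and no instance of them is claimed.  Nothing here says anything about the status of the Hodge conjecture for CM
abelian varieties, which is NOT proved (HC_CM is NOT proved by anyone in this repository).
-/

set_option autoImplicit false

noncomputable section

namespace Summit.Ventures.HodgeRepro.Tier4.Line1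

open NumberField Common PeriodCloser MeasureTheory RTF

namespace RTF

namespace Setting

section Blocks

variable {G : Type} [Group G] [TopologicalSpace G] [IsTopologicalGroup G] [MeasurableSpace G] [BorelSpace G]
  (S : Setting G) (χ : S.T → ℂ) (χ' : S.T' → ℂ) (φ : ℕ → G → ℂ) (n : ℕ → ℕ) (f₁ f₂ : G → ℂ)

/-- **the `j`-th spectral term** of the RTF at the test pair `(f₁, f₂)` over the adapted family `φ`:
`ℓ_{χ′}(R(f₂ˇ) φ_j) · conj ℓ_χ(R(f̄₁) φ_j)` — the summand of L1.2b `rtf_spectral`. -/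
def specTerm (j : ℕ) : ℂ :=
  S.periodT' χ' (fun t' => S.R (refl f₂) (φ j) t') * starRingEnd ℂ (S.periodT χ (fun t => S.R (cj f₁) (φ j) t))

/-- **the `τ m`-block** of the spectral expansion: the sum of the terms whose basis vector lies in `τ m`
(`n j = m`). -/
def specBlock (m : ℕ) : ℂ := ∑' j : n ⁻¹' {m}, specTerm S χ χ' φ f₁ f₂ j

omit [IsTopologicalGroup G] [BorelSpace G] in
/-- a term of the `m`-block is indexed by a `j` with `n j = m`. -/
theorem specBlock_eq_zero_of_forall {m : ℕ} (h : ∀ j, n j = m → specTerm S χ χ' φ f₁ f₂ j = 0) :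
    specBlock S χ χ' φ n f₁ f₂ m = 0 := by
  unfold specBlock
  have hz : (fun j : n ⁻¹' {m} => specTerm S χ χ' φ f₁ f₂ j) = fun _ => 0 := by
    funext j
    exact h j j.2
  rw [hz, tsum_zero]

omit [IsTopologicalGroup G] [BorelSpace G] in
/-- a non-zero `m`-block has a non-zero term with `n j = m`. -/
theorem exists_specTerm_ne_zero_of_specBlock_ne_zero {m : ℕ} (h : specBlock S χ χ' φ n f₁ f₂ m ≠ 0) :
    ∃ j, n j = m ∧ specTerm S χ χ' φ f₁ f₂ j ≠ 0 := by
  by_contra hall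
  apply h
  apply specBlock_eq_zero_of_forall
  intro j hj
  by_contra hne
  exact hall ⟨j, hj, hne⟩

/-- **L1.2b in block form** (the theorem of record of this file, over EVERY `RTF.Setting G`): the spectral expansion
of `J(f₁ ⋆ f₂)` regrouped along the invariant subspaces, `J(f₁ ⋆ f₂) = Σ_m specBlock m` — Mathlib's
`HasSum.tsum_fiberwise`, i.e. `HasSum.sigma` transported along `Equiv.sigmaFiberEquiv n` with the fibre sums
supplied by `Summable.subtype` (ℂ is complete). -/
theorem hasSum_specBlock (hχ : S.IsCharacter χ) (hχ' : S.IsCharacter' χ') {τ : ℕ → Set (G → ℂ)}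
    (hB : S.IsAdaptedONB τ φ n) (h₁ : IsTest f₁) (h₂ : IsTest f₂) :
    HasSum (specBlock S χ χ' φ n f₁ f₂) (S.J χ χ' (S.conv f₁ f₂)) :=
  (S.rtf_spectral hχ hχ' hB h₁ h₂).tsum_fiberwise n

/-- a non-zero `J(f₁ ⋆ f₂)` has a non-zero block. -/
theorem exists_specBlock_ne_zero (hχ : S.IsCharacter χ) (hχ' : S.IsCharacter' χ') {τ : ℕ → Set (G → ℂ)}
    (hB : S.IsAdaptedONB τ φ n) (h₁ : IsTest f₁) (h₂ : IsTest f₂) (hJ : S.J χ χ' (S.conv f₁ f₂) ≠ 0) :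
    ∃ m, specBlock S χ χ' φ n f₁ f₂ m ≠ 0 :=
  exists_term_ne_zero (S.hasSum_specBlock χ χ' φ n f₁ f₂ hχ hχ' hB h₁ h₂) hJ

omit [BorelSpace G] in
/-- **L1.5 in block form**: a non-zero `m`-block exhibits both toric functionals on `τ m` and a vector of `τ m` hit by
`f̄₁`. -/
theorem atoms_of_specBlock_ne_zero {τ : ℕ → Set (G → ℂ)} (hB : S.IsAdaptedONB τ φ n) (h₁ : IsTest f₁)
    (h₂ : IsTest f₂) {m : ℕ} (h : specBlock S χ χ' φ n f₁ f₂ m ≠ 0) :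
    S.PeriodNonzeroT χ (τ m) ∧ S.PeriodNonzeroT' χ' (τ m) ∧ S.Hit (cj f₁) (τ m) := by
  obtain ⟨j, hj, hne⟩ := S.exists_specTerm_ne_zero_of_specBlock_ne_zero χ χ' φ n f₁ f₂ h
  have := S.atoms hB h₁ h₂ j hne
  rw [hj] at this
  exact this

end Blocks

end Setting

end RTF

section Interface

variable {L : Type} [Field L] [NumberField L] [IsCMField L]
  {Form : Type} [AddCommGroup Form] [Module ℂ Form] {A : FormAlgebra Form} {W : Witness A}
  {Θ : ThetaLifts W} (E₀ : EndoscopicSide L W Θ)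
  {G : Type} [Group G] [TopologicalSpace G] [IsTopologicalGroup G] [MeasurableSpace G] [BorelSpace G]
  (S : RTF.Setting G) (χ : S.T → ℂ) (χ' : S.T' → ℂ) (τ : ℕ → Set (G → ℂ)) (tl : Θ.U1Char → ℕ) (Lift : ℕ → Prop)
  (φ : ℕ → G → ℂ) (n : ℕ → ℕ) (tf : W.Translates → (G → ℂ) × (G → ℂ)) (spec : W.Translates → Finset ℕ)

/-- **The RTF-defined spectral interface** on the RTF-instantiated face: for a DISPLAYED test-pair map `tf` (the
test functions of a Hecke choice of translates) and a displayed finite spectrum `spec`, the `τ m`-term of the choice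
`γ` is the `m`-block of the RTF's spectral expansion at `tf γ`.  `tf` and `spec` are DATA OF THE RESIDUAL (plan-1
S13462 (5)(a)): the Schwartz / test data of each Hecke choice and its finite spectrum are constructed nowhere in the
tree; this definition only fixes what the identification (S1′) and the isolation (S3′) below are statements ABOUT. -/
def spectralOfRTF : SpectralInterface (sideWithRTFSpectrum E₀ S χ χ' τ tl Lift).toC7Face where
  spectrum := spec
  tauPairing := fun γ m => S.specBlock χ χ' φ n (tf γ).1 (tf γ).2 m

omit [IsTopologicalGroup G] [BorelSpace G] in
/-- the spectrum of the RTF-defined interface is the displayed `spec`. -/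
theorem spectrum_spectralOfRTF (γ : W.Translates) :
    (spectralOfRTF E₀ S χ χ' τ tl Lift φ n tf spec).spectrum γ = spec γ := rfl

omit [IsTopologicalGroup G] [BorelSpace G] in
/-- the `τ`-term of the RTF-defined interface is the RTF's block at the test pair of the choice. -/
theorem tauPairing_spectralOfRTF (γ : W.Translates) (m : ℕ) :
    (spectralOfRTF E₀ S χ χ' τ tl Lift φ n tf spec).tauPairing γ m =
      S.specBlock χ χ' φ n (tf γ).1 (tf γ).2 m := rfl

/-- **(S1′) — THE IDENTIFICATION, DISPLAYED**: the concrete Hodge pairing of the choice `γ` is the finite sum over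
the displayed spectrum of the RTF's blocks at the test pair of `γ`.  This is the identification (i) of ROUTE.md §4
item 2 in night-2's split ((D0) the corner forms are theta lifts, (D2) wedge = isotypic projection of the plane
kernel, Howe duality for the cross terms); it is a HYPOTHESIS wherever it is used and is proved nowhere. -/
def SpectralIdentification : Prop :=
  ∀ γ : W.Translates, W.hodgePairing γ = ∑ m ∈ spec γ, S.specBlock χ χ' φ n (tf γ).1 (tf γ).2 m

omit [IsTopologicalGroup G] [BorelSpace G] in
/-- (S1) on the RTF-defined interface IS `SpectralIdentification`, definitionally. -/
theorem spectralDecomposition_iff_identification :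
    SpectralDecomposition (sideWithRTFSpectrum E₀ S χ χ' τ tl Lift).toC7Face
        (spectralOfRTF E₀ S χ χ' τ tl Lift φ n tf spec) ↔
      SpectralIdentification S χ χ' φ n tf spec :=
  Iff.rfl

/-- **(S3′) — ISOLATION WITH A NON-ZERO BLOCK, DISPLAYED**: an invariant subspace `τ m` carrying both toric
functionals and the lift clause is the whole displayed spectrum of some Hecke choice whose `m`-block is non-zero
(Hecke isolation + the Rallis inner product formula); a HYPOTHESIS wherever it is used, proved nowhere. -/
def IsolationNonvanishing : Prop :=
  ∀ m : ℕ, S.PeriodNonzeroT χ (τ m) → S.PeriodNonzeroT' χ' (τ m) → Lift m →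
    ∃ γ' : W.Translates, spec γ' = {m} ∧ S.specBlock χ χ' φ n (tf γ').1 (tf γ').2 m ≠ 0

omit [IsTopologicalGroup G] [BorelSpace G] in
/-- (S3) on the RTF-defined interface from `IsolationNonvanishing` (the choice of translates in (S3)'s hypothesis
is idle: the toric functionals of the instantiated face do not depend on it). -/
theorem isolateTerm_of_isolationNonvanishing (h : IsolationNonvanishing S χ χ' τ Lift φ n tf spec) :
    IsolateTerm (sideWithRTFSpectrum E₀ S χ χ' τ tl Lift).toC7Face
      (spectralOfRTF E₀ S χ χ' τ tl Lift φ n tf spec) := by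
  intro γ m hi hl
  exact h m (hi 0) (hi 1) hl

omit [IsTopologicalGroup G] [BorelSpace G] in
/-- `IsolationNonvanishing` from (S3) on the RTF-defined interface, for any choice of translates. -/
theorem isolationNonvanishing_of_isolateTerm (γ₀ : W.Translates)
    (h : IsolateTerm (sideWithRTFSpectrum E₀ S χ χ' τ tl Lift).toC7Face
      (spectralOfRTF E₀ S χ χ' τ tl Lift φ n tf spec)) :
    IsolationNonvanishing S χ χ' τ Lift φ n tf spec := by
  intro m hT hT' hl
  refine h γ₀ m ?_ hl
  intro i
  fin_cases i
  · exact hT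
  · exact hT'

omit [BorelSpace G] in
/-- **(S2) on the RTF-defined interface is a theorem** modulo the lift clause: a non-zero `m`-block at the test pair of
`γ` exhibits both toric functionals on `τ m` (L1.5 `atoms`) and, through the displayed lift hypothesis at that test
pair, the lift clause. -/
theorem termFactors_spectralOfRTF (hB : S.IsAdaptedONB τ φ n) (h₁ : ∀ γ, IsTest (tf γ).1)
    (h₂ : ∀ γ, IsTest (tf γ).2)
    (hlift : ∀ γ m, S.PeriodNonzeroT χ (τ m) → S.PeriodNonzeroT' χ' (τ m) → S.Hit (cj (tf γ).1) (τ m) → Lift m) :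
    TermFactors (sideWithRTFSpectrum E₀ S χ χ' τ tl Lift).toC7Face
      (spectralOfRTF E₀ S χ χ' τ tl Lift φ n tf spec) := by
  intro γ m hne
  obtain ⟨hT, hT', hhit⟩ := S.atoms_of_specBlock_ne_zero χ χ' φ n (tf γ).1 (tf γ).2 hB (h₁ γ) (h₂ γ) hne
  refine ⟨?_, hlift γ m hT hT' hhit⟩
  intro i
  fin_cases i
  · exact hT
  · exact hT'

omit [BorelSpace G] in
/-- **The seesaw components by name from the two displayed identities** (+ the lift clause at every test pair for
(S2)): this rebuilds the binder `hseesaw` of `conclusion_of_rtf_inputs` on the RTF-defined interface. -/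
theorem seesawComponents_spectralOfRTF (hB : S.IsAdaptedONB τ φ n) (h₁ : ∀ γ, IsTest (tf γ).1)
    (h₂ : ∀ γ, IsTest (tf γ).2)
    (hlift : ∀ γ m, S.PeriodNonzeroT χ (τ m) → S.PeriodNonzeroT' χ' (τ m) → S.Hit (cj (tf γ).1) (τ m) → Lift m)
    (hS1 : SpectralIdentification S χ χ' φ n tf spec) (hS3 : IsolationNonvanishing S χ χ' τ Lift φ n tf spec) :
    SeesawComponents (sideWithRTFSpectrum E₀ S χ χ' τ tl Lift).toC7Face
      (spectralOfRTF E₀ S χ χ' τ tl Lift φ n tf spec) where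
  decomp := hS1
  factors := termFactors_spectralOfRTF E₀ S χ χ' τ tl Lift φ n tf spec hB h₁ h₂ hlift
  isolate := isolateTerm_of_isolationNonvanishing E₀ S χ χ' τ tl Lift φ n tf spec hS3

omit [BorelSpace G] in
/-- the binder `hseesaw` of `conclusion_of_rtf_inputs` from the two displayed identities. -/
theorem exists_seesaw_of_identification (hB : S.IsAdaptedONB τ φ n) (h₁ : ∀ γ, IsTest (tf γ).1)
    (h₂ : ∀ γ, IsTest (tf γ).2)
    (hlift : ∀ γ m, S.PeriodNonzeroT χ (τ m) → S.PeriodNonzeroT' χ' (τ m) → S.Hit (cj (tf γ).1) (τ m) → Lift m)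
    (hS1 : SpectralIdentification S χ χ' φ n tf spec) (hS3 : IsolationNonvanishing S χ χ' τ Lift φ n tf spec) :
    ∃ Sp : SpectralInterface (sideWithRTFSpectrum E₀ S χ χ' τ tl Lift).toC7Face,
      SeesawComponents (sideWithRTFSpectrum E₀ S χ χ' τ tl Lift).toC7Face Sp :=
  ⟨_, seesawComponents_spectralOfRTF E₀ S χ χ' τ tl Lift φ n tf spec hB h₁ h₂ hlift hS1 hS3⟩

/-- **(P) for the witness from the RTF inputs and the two displayed identities**, DIRECTLY (no (S2) needed: the
`(P′) ⟹ (P)` direction uses (S1) and (S3) only): the DEFINED content produces `m` with both toric functionals on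
`τ m` hit by `f̄₁`, the lift hypothesis gives `Lift m`, (S3′) a choice `γ'` with spectrum `{m}` and a non-zero
`m`-block, (S1′) at `γ'` says the Hodge pairing of `γ'` is that block. -/
theorem P_of_rtf_identification (hχ : S.IsCharacter χ) (hχ' : S.IsCharacter' χ') (hB : S.IsAdaptedONB τ φ n)
    {f₁ f₂ : G → ℂ} (h₁ : IsTest f₁) (h₂ : IsTest f₂) (hconv : IsTest (S.conv f₁ f₂)) {o₀ : S.Orbit}
    (hiso : S.geoSupport (S.conv f₁ f₂) = {o₀}) (hne : S.orbital χ χ' o₀ (S.conv f₁ f₂) ≠ 0)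
    (hlift : ∀ m, S.PeriodNonzeroT χ (τ m) → S.PeriodNonzeroT' χ' (τ m) → S.Hit (cj f₁) (τ m) → Lift m)
    (hS1 : SpectralIdentification S χ χ' φ n tf spec) (hS3 : IsolationNonvanishing S χ χ' τ Lift φ n tf spec) :
    W.P := by
  obtain ⟨m, hT, hT', hhit⟩ := S.exists_periods_of_isolation hχ hχ' hB h₁ h₂ hconv hiso hne
  obtain ⟨γ', hsp, hblk⟩ := hS3 m hT hT' (hlift m hT hT' hhit)
  refine ⟨γ', ?_⟩
  rw [hS1 γ', hsp, Finset.sum_singleton]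
  exact hblk

end Interface

section Target

variable {F E : Type} [Field F] [NumberField F] [IsGalois ℚ F] [IsCMField F]
  [Field E] [NumberField E] [IsGalois ℚ E] [IsCMField E]

/-- **The conclusion of `P_T4` for a datum `d` from the RTF inputs and the two displayed identities** — p3's
`conclusion_of_rtf_inputs` with its binder `hseesaw` replaced by the DEFINED interface's two identities (S1′)
`SpectralIdentification` and (S3′) `IsolationNonvanishing` (the test-pair map `tf` and the spectrum `spec` displayed
as data).  The theta lifts `Θ` and the side `E₀` of p3's statement are NOT binders here: the direct assembly
`P_of_rtf_identification` never passes through the face (they were the bookkeeping of the interface, not inputs of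
the conclusion).  Every other binder is p3's, verbatim. -/
theorem conclusion_of_rtf_identification (d : TargetData F E) {Γ' : Set (Matrix (Fin 3) (Fin 3) E)}
    (hΓ' : d.IsLevel Γ') (hcc : d.IsCocompact Γ')
    {G : Type} [Group G] [TopologicalSpace G] [IsTopologicalGroup G] [MeasurableSpace G] [BorelSpace G]
    (S : RTF.Setting G) {χ : S.T → ℂ} {χ' : S.T' → ℂ} (hχ : S.IsCharacter χ) (hχ' : S.IsCharacter' χ')
    {τ : ℕ → Set (G → ℂ)} {φ : ℕ → G → ℂ} {n : ℕ → ℕ} (hB : S.IsAdaptedONB τ φ n) {f₁ f₂ : G → ℂ}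
    (h₁ : RTF.IsTest f₁) (h₂ : RTF.IsTest f₂) (hconv : RTF.IsTest (S.conv f₁ f₂)) {o₀ : S.Orbit}
    (hiso : S.geoSupport (S.conv f₁ f₂) = {o₀}) (hne : S.orbital χ χ' o₀ (S.conv f₁ f₂) ≠ 0)
    (Lift : ℕ → Prop)
    (hlift : ∀ m, S.PeriodNonzeroT χ (τ m) → S.PeriodNonzeroT' χ' (τ m) → S.Hit (RTF.cj f₁) (τ m) → Lift m)
    (tf : (d.concreteWitness hΓ' (isDomain_dom d hΓ').subset_ball (isDomain_dom d hΓ').measurableSet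
      (d.residual_of_cocompact hΓ' hcc)).Translates → (G → ℂ) × (G → ℂ))
    (spec : (d.concreteWitness hΓ' (isDomain_dom d hΓ').subset_ball (isDomain_dom d hΓ').measurableSet
      (d.residual_of_cocompact hΓ' hcc)).Translates → Finset ℕ)
    (hS1 : SpectralIdentification S χ χ' φ n tf spec) (hS3 : IsolationNonvanishing S χ χ' τ Lift φ n tf spec) :
    d.conclusion :=
  d.conclusion_of_concrete_P_cocompact hΓ' hcc
    (P_of_rtf_identification (A := d.holoFormAlgebra Γ' (isDomain_dom d hΓ').subset_ball
      (isDomain_dom d hΓ').measurableSet (d.residual_of_cocompact hΓ' hcc).pos (d.residual_of_cocompact hΓ' hcc).fin)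
      (W := d.concreteWitness hΓ' (isDomain_dom d hΓ').subset_ball (isDomain_dom d hΓ').measurableSet
        (d.residual_of_cocompact hΓ' hcc))
      S χ χ' τ Lift φ n tf spec hχ hχ' hB h₁ h₂ hconv hiso hne hlift hS1 hS3)

end Target

end Summit.Ventures.HodgeRepro.Tier4.Line1

end
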